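import Literature.Analysis.FunctionSpaces.PolchinskiExchangeIneq
import HarnessLib

/-!
# The entropy production formula `d/dt E_{ν_t}[Φ(P_{0,t}F)] = −½ E_{ν_t}[Φ″(P_{0,t}F)(∇P_{0,t}F)²_{Ċ_t}]`
# (Bauerschmidt–Bodineau–Dagallier, proof of Theorem 3, (e:dEnt))

Topic `Literature/Analysis/FunctionSpaces`; "proof architecture" file behind the named fact
`Polchinski.BauerschmidtBodineau_multiscaleBakryEmery` ([BBD] Theorem 3, `MultiscaleBakryEmery.lean`).

[BBD] p0016 L47–75: with `F_t = P_{0,t}F` and `Φ(x) = x log x`,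
`d/dt E_{ν_t}[Φ(F_t)] = −E_{ν_t}[(L_t − ∂_t)Φ(F_t)] = −½E_{ν_t}[Φ″(F_t)(∇F_t)²_{Ċ_t}] = −2E_{ν_t}[(∇√F_t)²_{Ċ_t}]`
(dual identity + `(∂_t − L_t)F_t = 0` + chain rule).  This file proves the formula for a general `Φ ∈ C²`
with `Φ, Φ′, Φ″` bounded and `Φ′, Φ″` uniformly continuous (in the application `Φ` is a bounded smooth
function equal to `x log x` on the range `[a,b]` of `F`, exactly as [BBD] p0016 L40–45 arrange), for
`V₀, F ∈ C⁴` with bounded derivatives: the family `G_s = Φ(P_{0,s}F)` satisfies the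
hypotheses of `hasDerivAt_renormExpect_family` (chain rule for the `C_b²` data and for the uniform slope,
`uniformSlope_comp`), and the integrand `(L_t − ∂_t)Φ(F_t)` collapses to `½Φ″(F_t)(∇F_t)²_{Ċ_t}` by the
generator identity `∂_tF_t = L_tF_t` in jet form (`jet_generator`).

## Main result (sorry-free; no new definitions, no new named facts)

* **`hasDerivAt_renormExpect_comp_semigroup`** — for `t > 0`,
  `d/ds|_{s=t} E_{ν_s}[Φ(P_{0,s}F)] = −E_{ν_t}[½ Φ″(P_{0,t}F) Σ Ċ_t^{ij} ∂_iP_{0,t}F ∂_jP_{0,t}F]`.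

Nothing here concerns Yang–Mills.

## References

* [BauerschmidtBodineauDagallier2023] R. Bauerschmidt, T. Bodineau, B. Dagallier, Probab. Surveys 21
  (2024) 200–290, arXiv:2307.07619 — Theorem 3 proof p0016 L40–75 ((e:dEnt)). READ (held text).
* [Rudin1976] W. Rudin, Principles of Mathematical Analysis — Thm 5.5 (chain rule), 9.19.
-/

noncomputable section

-- nested operator-norm instances `E →L[ℝ] E →L[ℝ] ℝ`
set_option maxSynthPendingDepth 3

open MeasureTheory ProbabilityTheory Filter Topology Set
open scoped RealInnerProductSpace Matrix MatrixOrder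

namespace Literature.Analysis.FunctionSpaces

namespace Polchinski

variable {N : ℕ}

section Entropy

variable (D : CovDecomposition N) {V₀ F : EuclideanSpace ℝ (Fin N) → ℝ} {BV BF : ℝ}

set_option maxHeartbeats 1600000 in
/-- **Entropy production along the Polchinski flow** ([BBD] proof of Theorem 3, (e:dEnt), p0016 L47–75):
for `V₀, F ∈ C⁴(ℝ^N)` with bounded derivatives of orders `≤ 4`, and `Φ ∈ C²(ℝ)` with `Φ, Φ′, Φ″` bounded and
`Φ′, Φ″` uniformly continuous, for every `t > 0`
`d/ds|_{s=t} E_{ν_s}[Φ(P_{0,s}F)] = −E_{ν_t}[½ Φ″(P_{0,t}F) Σ_{ij} Ċ_t^{ij} ∂_iP_{0,t}F ∂_jP_{0,t}F]`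
(for `Φ(x) = x log x` on `[a,b]` the right-hand side is `−2E_{ν_t}[(∇√P_{0,t}F)²_{Ċ_t}]`).  No claim about
Yang–Mills is made. [cite: BauerschmidtBodineauDagallier2023, Theorem 3 (proof, (e:dEnt))] -/
theorem hasDerivAt_renormExpect_comp_semigroup
    (hV : ContDiff ℝ 4 V₀) (hVB : ∀ n ≤ 4, ∀ x, ‖iteratedFDeriv ℝ n V₀ x‖ ≤ BV)
    (hF : ContDiff ℝ 4 F) (hFB : ∀ n ≤ 4, ∀ x, ‖iteratedFDeriv ℝ n F x‖ ≤ BF)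
    {Φ Φ' Φ'' : ℝ → ℝ} (hΦ1 : ∀ x, HasDerivAt Φ (Φ' x) x) (hΦ2 : ∀ x, HasDerivAt Φ' (Φ'' x) x)
    {P0 P1 P2 : ℝ} (hP0 : ∀ x, |Φ x| ≤ P0) (hP1 : ∀ x, |Φ' x| ≤ P1) (hP2 : ∀ x, |Φ'' x| ≤ P2)
    (hΦ''u : UniformContinuous Φ'') {t : ℝ} (ht : 0 < t) :
    HasDerivAt (fun s => renormExpect D V₀ s fun y => Φ (semigroup D V₀ 0 s F y))
      (-(renormExpect D V₀ t fun y => (1 / 2) * Φ'' (semigroup D V₀ 0 t F y) *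
        ∑ i, ∑ j, D.Cdot t i j * (fderiv ℝ (semigroup D V₀ 0 t F) y (EuclideanSpace.single i 1) *
          fderiv ℝ (semigroup D V₀ 0 t F) y (EuclideanSpace.single j 1)))) t := by
  classical
  ---------------------------------------------------------------- data
  obtain ⟨hΨZ, hBZ⟩ := Cb4.exp_neg hV hVB
  obtain ⟨hΨW, hBW⟩ := Cb4.mul hΨZ hF hBZ hFB
  have hVc : Continuous V₀ := hV.continuous
  have hVabs : ∀ x, |V₀ x| ≤ BV := Cb4.abs_le hVB
  have hb : ∀ φ, -BV ≤ V₀ φ := fun φ => (abs_le.1 (hVabs φ)).1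
  have hVm : Measurable V₀ := hVc.measurable
  have hG1 := Cb4.hasFDerivAt hΨZ
  have hG2 := Cb4.hasFDerivAt_fderiv hΨZ
  have hK1 := Cb4.norm_fderiv_le hBZ
  have hM2 := Cb4.norm_fderiv₂_le hBZ
  have hUC2 := Cb4.uniformContinuous_fderiv₂ hΨZ hBZ
  have hm : (0 : ℝ) < Real.exp (-BV) := Real.exp_pos _
  have hBZ0 : (0 : ℝ) ≤ 24 * Real.exp BV * max BV 1 ^ 4 := by positivity
  have hBF0 : 0 ≤ BF := le_trans (norm_nonneg _) (hFB 0 (by norm_num) 0)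
  have hP10 : 0 ≤ P1 := (abs_nonneg _).trans (hP1 0)
  have hP20 : 0 ≤ P2 := (abs_nonneg _).trans (hP2 0)
  ---------------------------------------------------------------- atoms
  have pZ := fun s => sm_pack hΨZ hBZ (multivariateGaussian 0 (D.C s))
  have pW := fun s => sm_pack hΨW hBW (multivariateGaussian 0 (D.C s))
  have hZ1 := fun s k x =>
    sm_fderiv_apply hΨZ hBZ (multivariateGaussian 0 (D.C s)) x (EuclideanSpace.single k 1)
  have hW1 := fun s k x =>
    sm_fderiv_apply hΨW hBW (multivariateGaussian 0 (D.C s)) x (EuclideanSpace.single k 1)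
  have hmZ : ∀ s y, Real.exp (-BV) ≤
      ∫ ζ, Real.exp (-V₀ (y + ζ)) ∂(multivariateGaussian 0 (D.C s)) :=
    fun s y => exp_neg_le_integral_exp_neg hVc hVabs _ y
  have hsemi : ∀ s y, semigroup D V₀ 0 s F y =
      (∫ ζ, Real.exp (-V₀ (y + ζ)) * F (y + ζ) ∂(multivariateGaussian 0 (D.C s))) *
        (∫ ζ, Real.exp (-V₀ (y + ζ)) ∂(multivariateGaussian 0 (D.C s)))⁻¹ := fun s y => by
    rw [semigroup_zero_eq, exp_renormPotential_eq_inv D hVm hb, mul_comm]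
  have hZpos : ∀ s y, 0 < ∫ ζ, Real.exp (-V₀ (y + ζ)) ∂(multivariateGaussian 0 (D.C s)) :=
    fun s y => hm.trans_le (hmZ s y)
  ---------------------------------------------------------------- `Φ′` is `P2`-Lipschitz
  have hLip : ∀ x y, |Φ' x - Φ' y| ≤ P2 * |x - y| := by
    intro x y
    rw [← Real.norm_eq_abs, ← Real.norm_eq_abs (x - y)]
    exact Convex.norm_image_sub_le_of_norm_hasDerivWithin_le (𝕜 := ℝ) (s := univ)
      (fun z _ => (hΦ2 z).hasDerivWithinAt) (fun z _ => by rw [Real.norm_eq_abs]; exact hP2 z)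
      convex_univ (mem_univ y) (mem_univ x)
  have hΦ'u : UniformContinuous Φ' := by
    refine (LipschitzWith.of_dist_le_mul (K := Real.toNNReal P2) fun x y => ?_).uniformContinuous
    rw [Real.dist_eq, Real.dist_eq, Real.coe_toNNReal _ hP20]
    exact hLip x y
  have hΦc : Continuous Φ := continuous_iff_continuousAt.2 fun x => (hΦ1 x).continuousAt
  ---------------------------------------------------------------- jets of `u_t` at `t`
  obtain ⟨Du, D2u, K1u, K2u, pu, hDu, hD2u⟩ :=
    quotient_jets (pZ t) (pW t) hm (hmZ t) (semigroup D V₀ 0 t F) (hsemi t)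
  have hK1u : 0 ≤ K1u := (norm_nonneg _).trans (pu.2.2.2.1 0)
  have huUC : UniformContinuous (semigroup D V₀ 0 t F) := uc_of_hasFDerivAt_bound pu.1 pu.2.2.2.1
  have hDuUC : UniformContinuous Du := uc_of_hasFDerivAt_bound pu.2.1 pu.2.2.2.2.1
  ---------------------------------------------------------------- the slope of `u` at `t`
  have sZ := sm_uniformSlope D hΨZ hBZ ht
  have sW := sm_uniformSlope D hΨW hBW ht
  set Zd : EuclideanSpace ℝ (Fin N) → ℝ := fun y => (1 / 2) * ∑ i, ∑ j, D.Cdot t i j *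
    ∫ w, fderiv ℝ (fderiv ℝ (fun x => Real.exp (-V₀ x))) (y + w) (EuclideanSpace.single i 1)
      (EuclideanSpace.single j 1) ∂(multivariateGaussian 0 (D.C t)) with hZd_def
  set Wd : EuclideanSpace ℝ (Fin N) → ℝ := fun y => (1 / 2) * ∑ i, ∑ j, D.Cdot t i j *
    ∫ w, fderiv ℝ (fderiv ℝ (fun x => Real.exp (-V₀ x) * F x)) (y + w) (EuclideanSpace.single i 1)
      (EuclideanSpace.single j 1) ∂(multivariateGaussian 0 (D.C t)) with hWd_def
  -- bounds on `Zd`, `Wd`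
  have bsc : ∀ (i j : Fin N) y, |∫ w, fderiv ℝ (fderiv ℝ (fun x => Real.exp (-V₀ x))) (y + w)
      (EuclideanSpace.single i 1) (EuclideanSpace.single j 1) ∂(multivariateGaussian 0 (D.C t))| ≤
      24 * Real.exp BV * max BV 1 ^ 4 := fun i j y => by
    have h := (sm_scalar₂ hΨZ hBZ (multivariateGaussian 0 (D.C t))
      (EuclideanSpace.single i 1) (EuclideanSpace.single j 1)).2.1 y
    simpa only [Cb4.norm_single_one, mul_one] using h
  have bscW : ∀ (i j : Fin N) y, |∫ w, fderiv ℝ (fderiv ℝ (fun x => Real.exp (-V₀ x) * F x)) (y + w)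
      (EuclideanSpace.single i 1) (EuclideanSpace.single j 1) ∂(multivariateGaussian 0 (D.C t))| ≤
      16 * (24 * Real.exp BV * max BV 1 ^ 4) * BF := fun i j y => by
    have h := (sm_scalar₂ hΨW hBW (multivariateGaussian 0 (D.C t))
      (EuclideanSpace.single i 1) (EuclideanSpace.single j 1)).2.1 y
    simpa only [Cb4.norm_single_one, mul_one] using h
  set KZd : ℝ := (1 / 2) * ((∑ i, ∑ j, |D.Cdot t i j|) * (24 * Real.exp BV * max BV 1 ^ 4)) with hKZd
  set KWd : ℝ := (1 / 2) * ((∑ i, ∑ j, |D.Cdot t i j|) * (16 * (24 * Real.exp BV * max BV 1 ^ 4) * BF))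
    with hKWd
  have hlin : ∀ (c : Matrix (Fin N) (Fin N) ℝ) (f : Fin N → Fin N → ℝ) (B : ℝ),
      (∀ i j, |f i j| ≤ B) → |(1 / 2) * ∑ i, ∑ j, c i j * f i j| ≤ (1 / 2) * ((∑ i, ∑ j, |c i j|) * B) := by
    intro c f B hf
    rw [abs_mul, abs_of_pos (by norm_num : (0 : ℝ) < 1 / 2)]
    refine mul_le_mul_of_nonneg_left ?_ (by norm_num)
    rw [Finset.sum_mul]
    refine (Finset.abs_sum_le_sum_abs _ _).trans (Finset.sum_le_sum fun i _ => ?_)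
    rw [Finset.sum_mul]
    exact (Finset.abs_sum_le_sum_abs _ _).trans (Finset.sum_le_sum fun j _ => by
      rw [abs_mul]; exact mul_le_mul_of_nonneg_left (hf i j) (abs_nonneg _))
  have bZd : ∀ y, |Zd y| ≤ KZd := fun y => hlin _ _ _ fun i j => bsc i j y
  have bWd : ∀ y, |Wd y| ≤ KWd := fun y => hlin _ _ _ fun i j => bscW i j y
  have hKZd0 : 0 ≤ KZd := (abs_nonneg _).trans (bZd 0)
  -- the slope of `u = W/Z`
  have sIZ : ∀ ε : ℝ, 0 < ε → ∀ᶠ s in 𝓝 t, ∀ y,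
      |(∫ ζ, Real.exp (-V₀ (y + ζ)) ∂(multivariateGaussian 0 (D.C s)))⁻¹ -
        (∫ ζ, Real.exp (-V₀ (y + ζ)) ∂(multivariateGaussian 0 (D.C t)))⁻¹ -
        (s - t) * (-(Zd y) / (∫ ζ, Real.exp (-V₀ (y + ζ)) ∂(multivariateGaussian 0 (D.C t))) ^ 2)| ≤
        ε * |s - t| :=
    uniformSlope_inv sZ hm hmZ hKZd0 bZd
  have bIZ : ∀ s y, |(∫ ζ, Real.exp (-V₀ (y + ζ)) ∂(multivariateGaussian 0 (D.C s)))⁻¹| ≤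
      (Real.exp (-BV))⁻¹ := fun s y => by
    rw [abs_inv, abs_of_pos (hZpos s y)]
    exact inv_anti₀ hm (hmZ s y)
  have bIZd : ∀ y, |-(Zd y) / (∫ ζ, Real.exp (-V₀ (y + ζ)) ∂(multivariateGaussian 0 (D.C t))) ^ 2| ≤
      KZd / Real.exp (-BV) ^ 2 := fun y => by
    rw [abs_div, abs_neg, abs_of_pos (pow_pos (hZpos t y) 2)]
    exact div_le_div₀ hKZd0 (bZd y) (pow_pos hm 2) (pow_le_pow_left₀ hm.le (hmZ t y) 2)
  set ud : EuclideanSpace ℝ (Fin N) → ℝ := fun y =>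
    Wd y / (∫ ζ, Real.exp (-V₀ (y + ζ)) ∂(multivariateGaussian 0 (D.C t))) -
      (∫ ζ, Real.exp (-V₀ (y + ζ)) * F (y + ζ) ∂(multivariateGaussian 0 (D.C t))) * Zd y /
        (∫ ζ, Real.exp (-V₀ (y + ζ)) ∂(multivariateGaussian 0 (D.C t))) ^ 2 with hud_def
  have su : ∀ ε : ℝ, 0 < ε → ∀ᶠ s in 𝓝 t, ∀ y,
      |semigroup D V₀ 0 s F y - semigroup D V₀ 0 t F y - (s - t) * ud y| ≤ ε * |s - t| := by
    have h := uniformSlope_congr (uniformSlope_mul sW sIZ ((pW t).2.2.1) bIZ bWd bIZd) (fd' := ud)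
      fun y => by
        simp only [hud_def]
        ring
    intro ε hε
    filter_upwards [h ε hε] with s hs y
    rw [hsemi, hsemi]
    exact hs y
  -- regularity of `ud`
  have ucZd : UniformContinuous Zd ∧ ∀ y, |Zd y| ≤ KZd := by
    refine ⟨?_, bZd⟩
    refine uc_mul uniformContinuous_const (uc_finset_sum Finset.univ _ fun i _ =>
      uc_finset_sum Finset.univ _ fun j _ => uc_mul uniformContinuous_const
        (sm_scalar₂ hΨZ hBZ (multivariateGaussian 0 (D.C t)) (EuclideanSpace.single i 1)
          (EuclideanSpace.single j 1)).2.2 (fun _ => le_rfl) (bsc i j))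
      (A := |(1 / 2 : ℝ)|) (fun _ => le_rfl)
      (B := ∑ i, ∑ j, |D.Cdot t i j| * (24 * Real.exp BV * max BV 1 ^ 4)) fun y => ?_
    exact (Finset.abs_sum_le_sum_abs _ _).trans (Finset.sum_le_sum fun i _ =>
      (Finset.abs_sum_le_sum_abs _ _).trans (Finset.sum_le_sum fun j _ => by
        rw [abs_mul]; exact mul_le_mul_of_nonneg_left (bsc i j y) (abs_nonneg _)))
  have ucWd : UniformContinuous Wd := by
    refine uc_mul uniformContinuous_const (uc_finset_sum Finset.univ _ fun i _ =>
      uc_finset_sum Finset.univ _ fun j _ => uc_mul uniformContinuous_const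
        (sm_scalar₂ hΨW hBW (multivariateGaussian 0 (D.C t)) (EuclideanSpace.single i 1)
          (EuclideanSpace.single j 1)).2.2 (fun _ => le_rfl) (bscW i j))
      (A := |(1 / 2 : ℝ)|) (fun _ => le_rfl)
      (B := ∑ i, ∑ j, |D.Cdot t i j| * (16 * (24 * Real.exp BV * max BV 1 ^ 4) * BF)) fun y => ?_
    exact (Finset.abs_sum_le_sum_abs _ _).trans (Finset.sum_le_sum fun i _ =>
      (Finset.abs_sum_le_sum_abs _ _).trans (Finset.sum_le_sum fun j _ => by
        rw [abs_mul]; exact mul_le_mul_of_nonneg_left (bscW i j y) (abs_nonneg _)))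
  have ucZt : UniformContinuous fun y => ∫ ζ, Real.exp (-V₀ (y + ζ)) ∂(multivariateGaussian 0 (D.C t)) :=
    (sm_uniformContinuous hΨZ hBZ (multivariateGaussian 0 (D.C t))).1
  have ucWt : UniformContinuous fun y =>
      ∫ ζ, Real.exp (-V₀ (y + ζ)) * F (y + ζ) ∂(multivariateGaussian 0 (D.C t)) :=
    (sm_uniformContinuous hΨW hBW (multivariateGaussian 0 (D.C t))).1
  have ucIZ : UniformContinuous fun y =>
      (∫ ζ, Real.exp (-V₀ (y + ζ)) ∂(multivariateGaussian 0 (D.C t)))⁻¹ := uc_inv ucZt hm (hmZ t)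
  have uc_ud : UniformContinuous ud := by
    have h1 : UniformContinuous fun y =>
        Wd y * (∫ ζ, Real.exp (-V₀ (y + ζ)) ∂(multivariateGaussian 0 (D.C t)))⁻¹ :=
      uc_mul ucWd ucIZ bWd (bIZ t)
    have h2 : UniformContinuous fun y =>
        (∫ ζ, Real.exp (-V₀ (y + ζ)) * F (y + ζ) ∂(multivariateGaussian 0 (D.C t))) * Zd y *
          ((∫ ζ, Real.exp (-V₀ (y + ζ)) ∂(multivariateGaussian 0 (D.C t)))⁻¹ *
            (∫ ζ, Real.exp (-V₀ (y + ζ)) ∂(multivariateGaussian 0 (D.C t)))⁻¹) :=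
      uc_mul (uc_mul ucWt ucZd.1 ((pW t).2.2.1) bZd) (uc_mul ucIZ ucIZ (bIZ t) (bIZ t))
        (A := 16 * (24 * Real.exp BV * max BV 1 ^ 4) * BF * KZd) (fun y => by
          rw [abs_mul]
          exact mul_le_mul ((pW t).2.2.1 y) (bZd y) (abs_nonneg _)
            ((abs_nonneg _).trans ((pW t).2.2.1 y)))
        (B := (Real.exp (-BV))⁻¹ * (Real.exp (-BV))⁻¹) (fun y => by
          rw [abs_mul]
          exact mul_le_mul (bIZ t y) (bIZ t y) (abs_nonneg _) (by positivity))
    have he : ud = fun y => Wd y * (∫ ζ, Real.exp (-V₀ (y + ζ)) ∂(multivariateGaussian 0 (D.C t)))⁻¹ -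
        (∫ ζ, Real.exp (-V₀ (y + ζ)) * F (y + ζ) ∂(multivariateGaussian 0 (D.C t))) * Zd y *
          ((∫ ζ, Real.exp (-V₀ (y + ζ)) ∂(multivariateGaussian 0 (D.C t)))⁻¹ *
            (∫ ζ, Real.exp (-V₀ (y + ζ)) ∂(multivariateGaussian 0 (D.C t)))⁻¹) := by
      funext y; simp only [hud_def]; ring
    rw [he]
    exact h1.sub h2
  set Kud : ℝ := KWd * (Real.exp (-BV))⁻¹ +
    16 * (24 * Real.exp BV * max BV 1 ^ 4) * BF * KZd * ((Real.exp (-BV))⁻¹ * (Real.exp (-BV))⁻¹)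
    with hKud
  have b_ud : ∀ y, |ud y| ≤ Kud := fun y => by
    have he : ud y = Wd y * (∫ ζ, Real.exp (-V₀ (y + ζ)) ∂(multivariateGaussian 0 (D.C t)))⁻¹ -
        (∫ ζ, Real.exp (-V₀ (y + ζ)) * F (y + ζ) ∂(multivariateGaussian 0 (D.C t))) * Zd y *
          ((∫ ζ, Real.exp (-V₀ (y + ζ)) ∂(multivariateGaussian 0 (D.C t)))⁻¹ *
            (∫ ζ, Real.exp (-V₀ (y + ζ)) ∂(multivariateGaussian 0 (D.C t)))⁻¹) := by
      simp only [hud_def]; ring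
    rw [he]
    refine (abs_sub _ _).trans (add_le_add ?_ ?_)
    · rw [abs_mul]
      exact mul_le_mul (bWd y) (bIZ t y) (abs_nonneg _) ((abs_nonneg _).trans (bWd y))
    · rw [abs_mul, abs_mul]
      exact mul_le_mul (mul_le_mul ((pW t).2.2.1 y) (bZd y) (abs_nonneg _)
        ((abs_nonneg _).trans ((pW t).2.2.1 y))) (by
          rw [abs_mul]; exact mul_le_mul (bIZ t y) (bIZ t y) (abs_nonneg _) (by positivity))
        (abs_nonneg _) (by positivity)
  ---------------------------------------------------------------- the family `G_s = Φ(u_s)`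
  set G : ℝ → EuclideanSpace ℝ (Fin N) → ℝ := fun s y => Φ (semigroup D V₀ 0 s F y) with hG_def
  set DG : EuclideanSpace ℝ (Fin N) → EuclideanSpace ℝ (Fin N) →L[ℝ] ℝ :=
    fun y => Φ' (semigroup D V₀ 0 t F y) • Du y with hDG_def
  set D2G : EuclideanSpace ℝ (Fin N) → EuclideanSpace ℝ (Fin N) →L[ℝ] EuclideanSpace ℝ (Fin N) →L[ℝ] ℝ :=
    fun y => Φ' (semigroup D V₀ 0 t F y) • D2u y +
      (Φ'' (semigroup D V₀ 0 t F y) • Du y).smulRight (Du y) with hD2G_def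
  set Gd : EuclideanSpace ℝ (Fin N) → ℝ := fun y => Φ' (semigroup D V₀ 0 t F y) * ud y with hGd_def
  have hGt1 : ∀ y, HasFDerivAt (G t) (DG y) y := fun y =>
    (hΦ1 (semigroup D V₀ 0 t F y)).comp_hasFDerivAt y (pu.1 y)
  have hGt2 : ∀ y, HasFDerivAt DG (D2G y) y := fun y => by
    have hc : HasFDerivAt (fun y => Φ' (semigroup D V₀ 0 t F y))
        (Φ'' (semigroup D V₀ 0 t F y) • Du y) y :=
      (hΦ2 (semigroup D V₀ 0 t F y)).comp_hasFDerivAt y (pu.1 y)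
    exact hc.smul (pu.2.1 y)
  have hGc : ∀ s, Continuous (G s) := fun s =>
    hΦc.comp (continuous_iff_continuousAt.2 fun y => by
      have h := quotient_jets (pZ s) (pW s) hm (hmZ s) (semigroup D V₀ 0 s F) (hsemi s)
      obtain ⟨Du', D2u', K1', K2', pu', -, -⟩ := h
      exact (pu'.1 y).continuousAt)
  have hGb : ∀ s y, |G s y| ≤ P0 := fun s y => hP0 _
  have hDG : ∀ y, ‖DG y‖ ≤ P1 * K1u := fun y => by
    simp only [hDG_def, norm_smul, Real.norm_eq_abs]
    exact mul_le_mul (hP1 _) (pu.2.2.2.1 y) (norm_nonneg _) hP10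
  have hD2G : ∀ y, ‖D2G y‖ ≤ P1 * K2u + P2 * K1u * K1u := fun y => by
    refine (norm_add_le _ _).trans (add_le_add ?_ ?_)
    · rw [norm_smul, Real.norm_eq_abs]
      exact mul_le_mul (hP1 _) (pu.2.2.2.2.1 y) (norm_nonneg _) hP10
    · rw [ContinuousLinearMap.norm_smulRight_apply, norm_smul, Real.norm_eq_abs]
      exact mul_le_mul (mul_le_mul (hP2 _) (pu.2.2.2.1 y) (norm_nonneg _) hP20) (pu.2.2.2.1 y)
        (norm_nonneg _) (by positivity)
  have hΦ'uc : UniformContinuous fun y => Φ' (semigroup D V₀ 0 t F y) := hΦ'u.comp huUC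
  have hΦ''uc : UniformContinuous fun y => Φ'' (semigroup D V₀ 0 t F y) := hΦ''u.comp huUC
  have hUCG : UniformContinuous D2G :=
    (uc_smul hΦ'uc pu.2.2.2.2.2 (fun y => hP1 _) pu.2.2.2.2.1).add
      (uc_smulRight (uc_smul hΦ''uc hDuUC (fun y => hP2 _) pu.2.2.2.1) hDuUC
        (Cc := P2 * K1u) (fun y => by
          rw [norm_smul, Real.norm_eq_abs]
          exact mul_le_mul (hP2 _) (pu.2.2.2.1 y) (norm_nonneg _) hP20) pu.2.2.2.1)
  have hGdc : Continuous Gd := (hΦ'uc.continuous).mul uc_ud.continuous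
  have hGdb : ∀ y, |Gd y| ≤ P1 * Kud := fun y => by
    simp only [hGd_def, abs_mul]
    exact mul_le_mul (hP1 _) (b_ud y) (abs_nonneg _) hP10
  have hGduc : UniformContinuous Gd := uc_mul hΦ'uc uc_ud (fun y => hP1 _) b_ud
  have hKud0 : 0 ≤ Kud := (abs_nonneg _).trans (b_ud 0)
  have hUG : ∀ ε : ℝ, 0 < ε → ∀ᶠ s in 𝓝 t, ∀ y, |G s y - G t y - (s - t) * Gd y| ≤ ε * |s - t| :=
    uniformSlope_comp su b_ud hΦ1 hP1 hLip
  ---------------------------------------------------------------- the dual family identity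
  have hder := hasDerivAt_renormExpect_family D hG1 hG2 hb hK1 hM2 hUC2 ht (G := G) (Gd := Gd)
    hGt1 hGt2 hGc hGb hDG hD2G hUCG hGdc hGdb hGduc hUG
  refine hder.congr_deriv ?_
  congr 1
  refine congrArg _ (funext fun y => ?_)
  ---------------------------------------------------------------- the integrand: generator identity
  have hZne : (∫ ζ, Real.exp (-V₀ (y + ζ)) ∂(multivariateGaussian 0 (D.C t))) ≠ 0 := (hZpos t y).ne'
  have h1 := jet_generator (n := Fin N) (fun i j => D.Cdot_symm ht.le i j) hZne
    (W := ∫ ζ, Real.exp (-V₀ (y + ζ)) * F (y + ζ) ∂(multivariateGaussian 0 (D.C t)))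
    (Z1 := fun i => ∫ ζ, fderiv ℝ (fun x => Real.exp (-V₀ x)) (y + ζ) (EuclideanSpace.single i 1)
      ∂(multivariateGaussian 0 (D.C t)))
    (W1 := fun i => ∫ ζ, fderiv ℝ (fun x => Real.exp (-V₀ x) * F x) (y + ζ) (EuclideanSpace.single i 1)
      ∂(multivariateGaussian 0 (D.C t)))
    (g := fun k => Du y (EuclideanSpace.single k 1))
    (p := fun i => -(∫ ζ, fderiv ℝ (fun x => Real.exp (-V₀ x)) (y + ζ) (EuclideanSpace.single i 1)
      ∂(multivariateGaussian 0 (D.C t))) / ∫ ζ, Real.exp (-V₀ (y + ζ)) ∂(multivariateGaussian 0 (D.C t)))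
    (Z2 := fun i j => ∫ ζ, fderiv ℝ (fderiv ℝ (fun x => Real.exp (-V₀ x))) (y + ζ)
      (EuclideanSpace.single i 1) (EuclideanSpace.single j 1) ∂(multivariateGaussian 0 (D.C t)))
    (W2 := fun i j => ∫ ζ, fderiv ℝ (fderiv ℝ (fun x => Real.exp (-V₀ x) * F x)) (y + ζ)
      (EuclideanSpace.single i 1) (EuclideanSpace.single j 1) ∂(multivariateGaussian 0 (D.C t)))
    (N := fun i j => D2u y (EuclideanSpace.single i 1) (EuclideanSpace.single j 1))
    (Zd := Zd y) (Wd := Wd y) (ud := ud y)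
    (fun i j => sm_fderiv₂_symm hΨZ _ _ _ _) (fun i j => sm_fderiv₂_symm hΨW _ _ _ _)
    (fun k => by rw [hDu, hZ1 t, hW1 t]) (fun i => rfl)
    (fun i j => by
      rw [hD2u, hZ1 t, hZ1 t, hW1 t, hW1 t, sm_fderiv₂_apply hΨZ hBZ, sm_fderiv₂_apply hΨW hBW]
      ring)
    rfl rfl rfl
  -- expand the integrand
  have hfd : fderiv ℝ (semigroup D V₀ 0 t F) y = Du y := (pu.1 y).fderiv
  simp only [hD2G_def, hDG_def, hGd_def, hfd, _root_.add_apply, _root_.smul_apply, _root_.neg_apply,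
    ContinuousLinearMap.smulRight_apply, smul_eq_mul, hZ1 t]
  have e1 : ∑ i, ∑ j, D.Cdot t i j * (Φ' (semigroup D V₀ 0 t F y) *
      D2u y (EuclideanSpace.single i 1) (EuclideanSpace.single j 1) +
      Φ'' (semigroup D V₀ 0 t F y) * Du y (EuclideanSpace.single i 1) *
        Du y (EuclideanSpace.single j 1)) =
      Φ' (semigroup D V₀ 0 t F y) * ∑ i, ∑ j, D.Cdot t i j *
        D2u y (EuclideanSpace.single i 1) (EuclideanSpace.single j 1) +
      Φ'' (semigroup D V₀ 0 t F y) * ∑ i, ∑ j, D.Cdot t i j *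
        (Du y (EuclideanSpace.single i 1) * Du y (EuclideanSpace.single j 1)) := by
    rw [Finset.mul_sum, Finset.mul_sum, ← Finset.sum_add_distrib]
    refine Finset.sum_congr rfl fun i _ => ?_
    rw [Finset.mul_sum, Finset.mul_sum, ← Finset.sum_add_distrib]
    refine Finset.sum_congr rfl fun j _ => ?_
    ring
  have e2 : ∑ i, ∑ j, D.Cdot t i j *
      -((∫ ζ, Real.exp (-V₀ (y + ζ)) ∂(multivariateGaussian 0 (D.C t)))⁻¹ *
        ∫ ζ, fderiv ℝ (fun x => Real.exp (-V₀ x)) (y + ζ) (EuclideanSpace.single i 1)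
          ∂(multivariateGaussian 0 (D.C t))) *
      (Φ' (semigroup D V₀ 0 t F y) * Du y (EuclideanSpace.single j 1)) =
      Φ' (semigroup D V₀ 0 t F y) * ∑ i, ∑ j, D.Cdot t i j *
        (-(∫ ζ, fderiv ℝ (fun x => Real.exp (-V₀ x)) (y + ζ) (EuclideanSpace.single i 1)
            ∂(multivariateGaussian 0 (D.C t))) /
            (∫ ζ, Real.exp (-V₀ (y + ζ)) ∂(multivariateGaussian 0 (D.C t))) *
          Du y (EuclideanSpace.single j 1)) := by
    rw [Finset.mul_sum]
    refine Finset.sum_congr rfl fun i _ => ?_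
    rw [Finset.mul_sum]
    refine Finset.sum_congr rfl fun j _ => ?_
    ring
  rw [e1, e2, h1]
  ring

end Entropy

end Polchinski

end Literature.Analysis.FunctionSpaces

end
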